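import Summits.BirchSwinnertonDyer.Rank1Residual.X11b.Three.UpperHalfLocal
import Summits.BirchSwinnertonDyer.Rank1Residual.X11b.BDPRouteUpperField
import HarnessLib

/-!
# Class X11b at `p = 3` (team N8/O2, cell `b2b-bsdres`): the Euler-system half on (T2β)∖(T2α) from the two Shimura-curve shapes at a JSW-type field with `d_K` odd — every ODD prime (sub-target T-O2-T2B@3, part 3a: the bookkeeping core)

HONEST FRAMING (verbatim, cell `b2b-bsdres`, run/shared/lean/b2b/bsd-rank1-residual/): the goal of
the cell is to DELETE the COMBINATION-SHAPED residual classes for ALL analytic-rank `≤ 1` curves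
over `ℚ` — "full BSD formula for every rank `≤ 1` curve in class `C`" assembled STRICTLY from
published theorems — so that the rank-`≤ 1` remainder becomes exactly the CONSTRUCTION-SHAPED
classes, which are TYPED (missing-input Props), NOT attempted; this is not "finishing BSD".
Research route for class X11b (`ClassX11b W p := r_an = 1 ∧ p ≠ 2 ∧ mult(p) ∧ irr(p)`) at the prime
`p = 3`; no claim beyond the stated class and the sub-population named in each statement; nothing
booked; X11 ∧ `r = 1` at `p = 3` stays CONSTRUCTION-SHAPED (REFEREE R6.2). THEOREMS ONLY (no
definition, no named fact, no `sorry`).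

## What this file does

At `p ≥ 5` the route p2 of sub-cell `multr1-p2` types the Euler-system half
`Typed.MissingUpperBoundAt W p` on the Tamagawa atom (T2′) = (ram) ∧ `p ∣ ∏c_ℓ(E)` NOT wholesale
but, off the sub-shape (T2α) (`E` split multiplicative at `p` with `p ∣ ord_p Δ_min`), through the
two Shimura-curve shapes of Jetchev–Skinner–Wan 2017 §7.4.2 at a Friedberg–Hoffstein field — (U-Sh)
the Kolyvagin–Nekovář bound on `X_{N⁺,N⁻}` (JSW Thm. 4.4.1) and (GZ-Sh) the explicit Gross–Zagier
formula on `X_{N⁺,N⁻}` with its `N⁻`-term (`missingUpperBoundAt_of_classX11b_of_shimuraShapes_inertSet'`,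
`…_of_ram_of_not_alpha`; `5 ≤ p`). At `p = 3` the kernel of record (`bsdp_of_classX11b_three_of_onTreeInputs`)
still types (T2′) WHOLESALE (binder `hU`). This file carries the bookkeeping core to every ODD
prime on the sub-population where it is print-faithful — (β) every prime with `p ∣ c_ℓ(E)` is
MULTIPLICATIVE (at `p = 3` an ADDITIVE prime of Kodaira type IV / IV* has `c_ℓ = 3`, impossible for
`p ≥ 5`; only multiplicative primes can be put into `N⁻`) and `d_K` ODD (then the ramified primes
are `≥ 5` and carry `c_ℓ(E^{d_K}) ∈ {1,2,4}`, type `I₀*`, a tree theorem of the X2 sub-cell) —,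
using the odd-prime local lemmas of `UpperHalfLocal{,Mult}.lean`:

* `missingUpperBoundAt_of_classX11b_of_shimuraShapes_inertSet_odd` — the core at a JSW-type field
  with `d_K` odd and (β), every odd `p`: `Typed.MissingUpperBoundAt W p` ⇐ `hSk` (Skinner 2016
  Thm. C, printed for `p ≥ 3`), `hGZK`, `hmod` + (U-Sh), (GZ-Sh) at a point `P ∈ E(K)`;
* `exists_inertSet` — the even inert set `S` of JSW §7.4.2 at an X11b pair with a (ram) prime off
  (T2α) (the multiplicative carriers `ℓ ≠ p` of a `p`-divisible Tamagawa number, padded with the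
  (ram) witness), isolated from multr1-p2's construction, no `5 ≤ p`;
* `localData_of_field`, `odd_discr_of_two_dvd` — the local form of a Friedberg–Hoffstein field's
  splitting data (`(d_K/ℓ) = −1` / `d_K ≡ 5 mod 8` on `S`, `d_K ∈ ℚ_ℓ^{×2}` at the other bad
  primes, `p ∤ d_K`), and `d_K` odd whenever `2 ∣ N_E` (the bad prime `2` is unramified in `K`).

The class-level statements (Friedberg–Hoffstein field constructed; `BSD(E,p)` with THE open input;
the `p = 3` row) are in `UpperHalfShimura.lean`. CONDITIONAL on the named facts and the two shapes;
nothing booked; reach and labels UNCHANGED.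

References: [JetchevSkinnerWan2017] §7.4.2 (p. 31), §4.1 (H) (p. 17), Thm. 4.4.1 (p. 19);
[Skinner2016PacificMC] Thm. C and footnote 1; [CaiShuTian2014] Thm. 1.5; [PastenShimura2024] §6;
[Serre1973] Ch. II §3.3; [SilvermanATAEC1994] IV.9.4, Cor. IV.9.2(d); [Miller2011LMS] Def. 1.1.
-/

noncomputable section

open scoped Classical

open WeierstrassCurve NumberField IsDedekindDomain Literature.NumberTheory.EllipticCurves
  Rat.HeightOneSpectrum
  Literature.NumberTheory.EllipticCurves.ModularForms
  Literature.NumberTheory.EllipticCurves.Rank1Residual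
  Literature.NumberTheory.EllipticCurves.Rank1Residual.Typed
  Literature.NumberTheory.EllipticCurves.Wuthrich2014
  Literature.NumberTheory.EllipticCurves.BalakrishnanEtAl2019
  Literature.NumberTheory.QuadraticFields.Quadratic

namespace Summit.BirchSwinnertonDyer.Rank1Residual.X11b.Three

/-! ### Small bridges -/

/-- `(d/ℓ) = 1` forces `ℓ ∤ d`. [folklore] -/
theorem not_dvd_of_jacobiSym_eq_one {ℓ : ℕ} [Fact ℓ.Prime] {d : ℤ} (hJ : jacobiSym d ℓ = 1) :
    ¬ (ℓ : ℤ) ∣ d := by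
  intro h
  have hℓ : ℓ.Prime := Fact.out
  have h0 : jacobiSym d ℓ = 0 := by
    rw [jacobiSym.mod_left, Int.emod_eq_zero_of_dvd h, jacobiSym.zero_left hℓ.one_lt]
  rw [h0] at hJ
  exact absurd hJ (by decide)

/-! ### The bookkeeping core at a JSW-type field with `d_K` odd, every odd `p` -/

/-- **X11b, (ram) atom, sub-shape (T2β)∖(T2α): the Euler-system half from the two Shimura-curve
shapes at a field of JSW §7.4.2 type with `d_K` ODD — every ODD `p`, `p = 3` included.** For an
X11b pair `(E,p)` with a (ram) witness `ℓ₀`: given an imaginary quadratic `K` with `d_K` odd, a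
finite set `S ∌ p` of primes, multiplicative for `E` and inert in `K` (`(d_K/ℓ) = −1`, resp.
`d_K ≡ 5 mod 8` at `ℓ = 2`), every bad prime outside `S` split, every split multiplicative prime
outside `S` très ramifié, (β) `p ∤ c_ℓ(E)` at every additive `ℓ`, `L(E^{d_K},1) ≠ 0`, a globally
minimal model `Wd` of the twist, and a point `P ∈ E(K)` with (U-Sh) and (GZ-Sh) (`N⁻`-term
`T = Σ_{ℓ∈S} ord_p(ord_ℓ Δ_min(E))`): `Typed.MissingUpperBoundAt E p` from the PUBLISHED facts
`hSk` (Skinner 2016 Thm. C, `p ≥ 3`), `hGZK`, `hmod` and the tree's local theorems (the numeric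
Tamagawa condition is `padicValNat_tamagawaProduct_add_twist_le_of_inertSet_odd`). multr1-p2's
`missingUpperBoundAt_of_classX11b_of_shimuraShapes_inertSet'` with `5 ≤ p` replaced by `d_K` odd +
(β). CONDITIONAL on the two shapes and the field; nothing booked; X11b stays CONSTRUCTION-SHAPED.
[cite: JetchevSkinnerWan2017, §7.4.2 (p. 31), Thm. 4.4.1 (p. 19), §4.1 (H) (p. 17)]
[cite: Skinner2016PacificMC, Thm. C (§1) and footnote 1] [cite: Miller2011LMS, Def. 1.1] -/
theorem missingUpperBoundAt_of_classX11b_of_shimuraShapes_inertSet_odd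
    -- published inputs (named facts of the tree)
    (hSk : Skinner2016.thmC_padicValRat_bsd_rank_zero)
    (hGZK : rank_eq_analyticRank_of_analyticRank_le_one) (hmod : hasEntireLFunction_rat)
    -- the pair, with a (ram) witness `ℓ₀`
    (W : WeierstrassCurve ℚ) [W.IsElliptic] [W.IsGloballyMinimal] (p : ℕ) [Fact p.Prime]
    (hX : ClassX11b W p)
    {ℓ₀ : ℕ} [Fact ℓ₀.Prime] (hℓ₀ : ℓ₀ ≠ p) (hmult₀ : Mult W ℓ₀)
    (hram₀ : ¬ p ∣ padicValInt ℓ₀ W.minimalDiscriminantInt)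
    -- (β): `p ∤ c_ℓ(E)` at the additive primes
    (hβ : ∀ (ℓ : ℕ) [Fact ℓ.Prime], ¬ W.HasGoodReductionAtPrime ℓ → ¬ Mult W ℓ →
      ¬ p ∣ (W.baseChange ℚ_[ℓ]).localTamagawaNumber ℤ_[ℓ])
    -- the field (`d_K` odd) and the inert set
    (K : Type) [Field K] [NumberField K] (hK : IsImaginaryQuadratic K)
    (hodd : Odd (NumberField.discr K)) (S : Finset ℕ) (hpS : p ∉ S)
    (hS : ∀ ℓ ∈ S, ∃ _ : Fact ℓ.Prime, Mult W ℓ ∧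
      ((ℓ ≠ 2 ∧ jacobiSym (NumberField.discr K) ℓ = -1) ∨ (ℓ = 2 ∧ NumberField.discr K % 8 = 5)))
    (hsplit : ∀ (ℓ : ℕ) [Fact ℓ.Prime], ¬ W.HasGoodReductionAtPrime ℓ → ℓ ∉ S →
      IsSquare (algebraMap ℚ ℚ_[ℓ] (NumberField.discr K : ℚ)))
    (hpd : ¬ (p : ℤ) ∣ NumberField.discr K)
    (hFC : ∀ (ℓ : ℕ) [Fact ℓ.Prime], ℓ ∉ S → W.HasSplitMultiplicativeReductionAtPrime ℓ →
      ¬ p ∣ padicValInt ℓ W.minimalDiscriminantInt)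
    -- the twist
    (hLt : (W.quadraticTwist (NumberField.discr K : ℚ)).entireLFunction 1 ≠ 0)
    (Wd : WeierstrassCurve ℚ) [Wd.IsElliptic] [Wd.IsGloballyMinimal] (Cd : VariableChange ℚ)
    (hWd : Cd • W.quadraticTwist (NumberField.discr K : ℚ) = Wd)
    -- the point and the two shapes, with the `N⁻`-term of `S`
    (P : (W.baseChange K).toAffine.Point)
    (hGZSh : ∃ qE qd : ℚ, qE ≠ 0 ∧ qd ≠ 0 ∧
      W.leadingLCoeff / ((W.realPeriodRat : ℂ) * (W.regulator : ℂ)) = (qE : ℂ) ∧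
      Wd.entireLFunction 1 / (Wd.realPeriodRat : ℂ) = (qd : ℂ) ∧
      (2 * padicValNat p (AddSubgroup.zmultiples P).index : ℤ) +
          (∑ ℓ ∈ S, padicValNat p (padicValInt ℓ W.minimalDiscriminantInt) : ℕ) =
        padicValRat p qE + padicValRat p qd)
    (hUSh : Nat.card (AddCommGroup.primaryComponent (W.baseChange K).sha p) ≤
      p ^ (2 * padicValNat p (AddSubgroup.zmultiples P).index)) :
    Typed.MissingUpperBoundAt W p := by
  obtain ⟨hr, hp2, hmult, hirr⟩ := hX
  have hp3 : 3 ≤ p := by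
    have := (Fact.out : p.Prime).two_le
    omega
  have h2 : Module.finrank ℚ K = 2 := hK.1
  have hD0 : (NumberField.discr K : ℚ) ≠ 0 := by exact_mod_cast NumberField.discr_ne_zero K
  haveI hEt : (W.quadraticTwist (NumberField.discr K : ℚ)).IsElliptic :=
    W.isElliptic_quadraticTwist hD0
  have hsqp : IsSquare (algebraMap ℚ ℚ_[p] (NumberField.discr K : ℚ)) :=
    hsplit p (WeierstrassCurve.HasMultiplicativeReduction.not_hasGoodReduction (R := ℤ_[p]) hmult) hpS
  have hT := padicValNat_tamagawaProduct_add_twist_le_of_inertSet_odd W p hp2 K hK hodd hpd Cd hWd S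
    hS (fun ℓ _ hg hℓS ↦ hsplit ℓ hg hℓS) (fun ℓ _ hℓS hs ↦ hFC ℓ hℓS hs) (fun ℓ _ hg hm ↦ hβ ℓ hg hm)
  -- the twist: multiplicative at `p`, irreducible, (ram) through `ℓ₀` (split, odd inert or `2` inert)
  have hmultd : Wd.HasMultiplicativeReductionAtPrime p := by
    rw [← hWd, hasMultiplicativeReductionAtPrime_smul_iff]
    exact (hasMultiplicativeReductionAtPrime_quadraticTwist_iff W hD0 hsqp).mpr hmult
  have hirrd : Wd.HasIrreducibleModPGaloisRep p :=
    hasIrreducibleModPGaloisRep_twist_model W p K h2 hirr Cd hWd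
  have hramd : Ram Wd p := by
    by_cases h0S : ℓ₀ ∈ S
    · obtain ⟨_, -, hcase⟩ := hS ℓ₀ h0S
      rcases hcase with ⟨h02, hJ0⟩ | ⟨h0eq, h8⟩
      · exact ram_twist_of_inert_witness W K Cd hWd ℓ₀ h02 hJ0 p hℓ₀ hmult₀ hram₀
      · subst h0eq
        exact ram_twist_of_inert_witness_two W K Cd hWd h8 p hℓ₀ hmult₀ hram₀
    · have hsq₀ : IsSquare (algebraMap ℚ ℚ_[ℓ₀] (NumberField.discr K : ℚ)) :=
        hsplit ℓ₀ (WeierstrassCurve.HasMultiplicativeReduction.not_hasGoodReduction (R := ℤ_[ℓ₀])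
          hmult₀) h0S
      refine ⟨ℓ₀, inferInstance, hℓ₀, ?_, ?_⟩
      · rw [← hWd, hasMultiplicativeReductionAtPrime_smul_iff]
        exact (hasMultiplicativeReductionAtPrime_quadraticTwist_iff W hD0 hsq₀).mpr hmult₀
      · rwa [padicValInt_minimalDiscriminantInt_twist_eq W ℓ₀ hD0 hsq₀ Cd hWd]
  -- Skinner's Thm. C for the twist, then the bookkeeping core
  have hLt' : (W.quadraticTwist (NumberField.discr K : ℚ)).entireLFunction = Wd.entireLFunction := by
    rw [← hWd, entireLFunction_smul]
  have hLd1 : Wd.entireLFunction 1 ≠ 0 := by rw [← hLt']; exact hLt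
  have hfinSd : Wd.ShaFinite := (hGZK Wd (by
    rw [(Wd.analyticRank_eq_zero_iff_holds (hmod Wd)).2 hLd1]; omega)).2
  have hfinW : W.ShaFinite := (hGZK W (by omega)).2
  obtain ⟨qd, hqd, hvqd⟩ := hSk Wd p hp3 (Or.inr hmultd) hirrd hramd hLd1 hfinSd
  exact missingUpperBoundAt_of_shimuraShapes W p hp2 K h2 Wd ⟨Cd, hWd⟩ hfinW hfinSd P _ hT
    ⟨qd, hqd, hvqd.le⟩ hGZSh hUSh

/-! ### The inert set and the local data of a Friedberg–Hoffstein field -/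

section FieldData

variable (W : WeierstrassCurve ℚ) [W.IsElliptic] [W.IsGloballyMinimal] (p : ℕ) [Fact p.Prime]

/-- **The inert set `S` of JSW §7.4.2 at an X11b pair with a (ram) prime, off (T2α).** `S` = the
split multiplicative primes `ℓ ≠ p` with `p ∣ ord_ℓ Δ_min(E)` (the multiplicative carriers of a
`p`-divisible Tamagawa number), padded to EVEN cardinality with the (ram) witness; every member is
multiplicative, `p ∉ S`, and every split multiplicative prime outside `S` is très ramifié
(`p ∤ ord_ℓ Δ_min`; at `ℓ = p` this is ¬(T2α)). The construction inside multr1-p2's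
`missingUpperBoundAt_of_classX11b_of_ram_of_not_alpha`, isolated; no `5 ≤ p`.
[cite: JetchevSkinnerWan2017, §7.4.2 (p. 31) and §4.1 (H) (p. 17)] -/
theorem exists_inertSet (hram : Ram W p)
    (hα : ¬ (W.HasSplitMultiplicativeReductionAtPrime p ∧ p ∣ padicValInt p W.minimalDiscriminantInt)) :
    ∃ S : Finset ℕ, Even S.card ∧ p ∉ S ∧
      (∀ ℓ ∈ S, ∃ _ : Fact ℓ.Prime, W.HasMultiplicativeReductionAtPrime ℓ) ∧
      (∀ (ℓ : ℕ) [Fact ℓ.Prime], ℓ ∉ S → W.HasSplitMultiplicativeReductionAtPrime ℓ →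
        ¬ p ∣ padicValInt ℓ W.minimalDiscriminantInt) := by
  have hN0 : W.conductorNorm ℤ ≠ 0 := (W.conductorNorm_pos_holds).ne'
  obtain ⟨ℓ₀, hℓ₀F, hℓ₀p, hmult₀, hram₀⟩ := hram
  -- the offending primes `ℓ ≠ p`
  set S₀ : Finset ℕ := (W.conductorNorm ℤ).primeFactors.filter (fun ℓ ↦ ℓ ≠ p ∧ ∃ h : ℓ.Prime,
      @WeierstrassCurve.HasSplitMultiplicativeReductionAtPrime W ℓ ⟨h⟩ ∧
        p ∣ padicValInt ℓ W.minimalDiscriminantInt) with hS₀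
  have hℓ₀S₀ : ℓ₀ ∉ S₀ := by
    intro h
    obtain ⟨-, -, _, -, hdvd⟩ := (Finset.mem_filter.mp h)
    exact hram₀ hdvd
  -- pad to even cardinality with the (ram) witness
  set S : Finset ℕ := if Even S₀.card then S₀ else insert ℓ₀ S₀ with hS
  have hS₀S : S₀ ⊆ S := by
    rw [hS]; split_ifs
    · exact le_rfl
    · exact Finset.subset_insert _ _
  have hmemS : ∀ ℓ ∈ S, ℓ ∈ S₀ ∨ ℓ = ℓ₀ := by
    intro ℓ hℓ; rw [hS] at hℓ; split_ifs at hℓ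
    · exact Or.inl hℓ
    · rcases Finset.mem_insert.mp hℓ with h | h
      · exact Or.inr h
      · exact Or.inl h
  refine ⟨S, ?_, ?_, ?_, ?_⟩
  · rw [hS]; split_ifs with he
    · exact he
    · rw [Finset.card_insert_of_notMem hℓ₀S₀]; exact Nat.even_add_one.mpr he
  · intro h
    rcases hmemS p h with h' | h'
    · exact (Finset.mem_filter.mp h').2.1 rfl
    · exact hℓ₀p h'.symm
  · intro ℓ hℓ
    rcases hmemS ℓ hℓ with h | rfl
    · obtain ⟨-, -, hℓp, hs, -⟩ := Finset.mem_filter.mp h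
      haveI : Fact ℓ.Prime := ⟨hℓp⟩
      exact ⟨inferInstance, hs.hasMultiplicativeReductionAtPrime⟩
    · exact ⟨hℓ₀F, hmult₀⟩
  · intro ℓ hℓF hℓS hs hdvd
    by_cases hℓp : ℓ = p
    · subst hℓp; exact hα ⟨hs, hdvd⟩
    · apply hℓS; apply hS₀S
      have hℓN : ℓ ∣ W.conductorNorm ℤ :=
        (W.dvd_conductorNorm_iff_not_hasGoodReductionAtPrime ℓ).mpr
          (WeierstrassCurve.HasMultiplicativeReduction.not_hasGoodReduction (R := ℤ_[ℓ])
            hs.hasMultiplicativeReductionAtPrime)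
      exact Finset.mem_filter.mpr ⟨Nat.mem_primeFactors.mpr ⟨hℓF.out, hℓN, hN0⟩, hℓp, hℓF.out, hs, hdvd⟩

omit [W.IsGloballyMinimal] in
variable {p} in
/-- **Local form of the splitting data of a Friedberg–Hoffstein-type field** (`S` inert with
`ℓ ∤ d_K`, the bad primes outside `S` split): at `ℓ ∈ S`, `(d_K/ℓ) = −1` (resp. `d_K ≡ 5 mod 8`
at `ℓ = 2`); at a bad prime outside `S`, `d_K ∈ ℚ_ℓ^{×2}`; and `p ∤ d_K` for the multiplicative
prime `p ∉ S` (it splits: `(d_K/p) = 1`). Bridges of `BDPRouteUpperField.lean` / `KroneckerSplitting`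
(Marcus Ch. 3 Thm. 25; Serre II.3.3). [cite: Serre1973, Ch. II §3.3 Thms 3–4] -/
theorem localData_of_field (hp2 : p ≠ 2) (hmult : Mult W p)
    {K : Type} [Field K] [NumberField K] (h2 : Module.finrank ℚ K = 2) {S : Finset ℕ}
    (hpS : p ∉ S) (hSmult : ∀ ℓ ∈ S, ∃ _ : Fact ℓ.Prime, W.HasMultiplicativeReductionAtPrime ℓ)
    (hinert : ∀ ℓ ∈ S, ((Ideal.span {(ℓ : ℤ)}).primesOver (𝓞 K)).ncard = 1 ∧
      ¬ (ℓ : ℤ) ∣ NumberField.discr K)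
    (hsplitN : ∀ ℓ : ℕ, ℓ.Prime → ℓ ∣ W.conductorNorm ℤ → ℓ ∉ S →
      ((Ideal.span {(ℓ : ℤ)}).primesOver (𝓞 K)).ncard = 2) :
    (∀ ℓ ∈ S, ∃ _ : Fact ℓ.Prime, Mult W ℓ ∧
      ((ℓ ≠ 2 ∧ jacobiSym (NumberField.discr K) ℓ = -1) ∨ (ℓ = 2 ∧ NumberField.discr K % 8 = 5))) ∧
    (∀ (ℓ : ℕ) [Fact ℓ.Prime], ¬ W.HasGoodReductionAtPrime ℓ → ℓ ∉ S →
      IsSquare (algebraMap ℚ ℚ_[ℓ] (NumberField.discr K : ℚ))) ∧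
    ¬ (p : ℤ) ∣ NumberField.discr K := by
  have hp : p.Prime := Fact.out
  refine ⟨?_, ?_, ?_⟩
  · intro ℓ hℓ
    obtain ⟨hℓF, hm⟩ := hSmult ℓ hℓ
    obtain ⟨hn, hd⟩ := hinert ℓ hℓ
    refine ⟨hℓF, hm, ?_⟩
    have hn' : ((Ideal.span {(ℓ : ℤ)}).primesOver (𝓞 K)).ncard ≠ 2 := by rw [hn]; decide
    by_cases hℓ2 : ℓ = 2
    · subst hℓ2
      have hn2 : ((Ideal.span {(2 : ℤ)}).primesOver (𝓞 K)).ncard ≠ 2 := by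
        simpa only [Nat.cast_ofNat] using hn'
      have hd2 : ¬ (2 : ℤ) ∣ NumberField.discr K := by simpa only [Nat.cast_ofNat] using hd
      exact Or.inr ⟨rfl, discr_emod_eight_eq_five_of_ncard_ne_two h2 hn2 hd2⟩
    · exact Or.inl ⟨hℓ2, jacobiSym_discr_eq_neg_one_of_ncard_ne_two h2 hℓF.out hℓ2 hn' hd⟩
  · intro ℓ hℓF hg hℓS
    have hℓN : ℓ ∣ W.conductorNorm ℤ := (W.dvd_conductorNorm_iff_not_hasGoodReductionAtPrime ℓ).mpr hg
    exact isSquare_discr_padic_of_ncard_eq_two h2 ℓ (hsplitN ℓ hℓF.out hℓN hℓS)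
  · have hpN : p ∣ W.conductorNorm ℤ :=
      (W.dvd_conductorNorm_iff_not_hasGoodReductionAtPrime p).mpr
        (WeierstrassCurve.HasMultiplicativeReduction.not_hasGoodReduction (R := ℤ_[p]) hmult)
    have hn := hsplitN p hp hpN hpS
    exact not_dvd_of_jacobiSym_eq_one ((ncard_primesOver_eq_two_iff_jacobiSym h2 hp hp2).mp hn)

omit [W.IsElliptic] [W.IsGloballyMinimal] [Fact p.Prime] in
variable {p} in
/-- **`d_K` is odd when `2 ∣ N_E`**: the bad prime `2` is either in `S` (inert, `2 ∤ d_K`) or split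
(`d_K ≡ 1 mod 8`, Marcus Ch. 3 Thm. 25). [cite: Serre1973, Ch. II §3.3 Thms 3–4] -/
theorem odd_discr_of_two_dvd {K : Type} [Field K] [NumberField K] (h2 : Module.finrank ℚ K = 2)
    {S : Finset ℕ}
    (hinert : ∀ ℓ ∈ S, ((Ideal.span {(ℓ : ℤ)}).primesOver (𝓞 K)).ncard = 1 ∧
      ¬ (ℓ : ℤ) ∣ NumberField.discr K)
    (hsplitN : ∀ ℓ : ℕ, ℓ.Prime → ℓ ∣ W.conductorNorm ℤ → ℓ ∉ S →
      ((Ideal.span {(ℓ : ℤ)}).primesOver (𝓞 K)).ncard = 2)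
    (h2N : 2 ∣ W.conductorNorm ℤ) : Odd (NumberField.discr K) := by
  by_cases h2S : 2 ∈ S
  · obtain ⟨-, hd⟩ := hinert 2 h2S
    have hd2 : ¬ (2 : ℤ) ∣ NumberField.discr K := by simpa only [Nat.cast_ofNat] using hd
    exact Int.odd_iff.mpr (by omega)
  · have hn := hsplitN 2 Nat.prime_two h2N h2S
    have hn2 : ((Ideal.span {(2 : ℤ)}).primesOver (𝓞 K)).ncard = 2 := by
      simpa only [Nat.cast_ofNat] using hn
    have h8 := (ncard_primesOver_two_eq_two_iff h2).mp hn2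
    exact Int.odd_iff.mpr (by omega)

end FieldData

end Summit.BirchSwinnertonDyer.Rank1Residual.X11b.Three

end
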